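import Literature.AlgebraicGeometry.Resolution.SmoothUniformization
import Mathlib.RingTheory.Valuation.ValuationSubring
import Mathlib.FieldTheory.PurelyInseparable.Basic

/-!
# `Valuative.TorsorToLurel`, line `Sketch`: valuation rings go up a purely inseparable extension

Route `ResolutionOfSingularities/Valuative`, support item `TorsorToLurel`
(stmt-ResolutionOfSingularities-10968). Helper file for the perfect-closure descent: the valued
function field `(K, O)` is base-changed up to the compositum `K' = K·k^{perf}`, a purely inseparable
extension of `K`, and one needs a valuation ring `O'` of `K'` lying over `O`.

* `stub_ttlValuationUp` — for a purely inseparable extension `L/K` and a valuation ring `O` of `K`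
  there is a valuation ring `O'` of `L` with `O' ∩ K = O`.

The purely inseparable hypothesis is not needed for existence (Chevalley's extension theorem,
in tree as `Literature.AlgebraicGeometry.Resolution.exists_valuationSubring_comap_eq`); it only
makes `O'` unique (`x ∈ O' ↔ x ^ p ^ n ∈ O`).
-/

noncomputable section

set_option linter.dupNamespace false -- mandated namespace of this single-conjunct summit

open IsLocalRing

namespace Summit.ResolutionOfSingularities.ResolutionOfSingularities.Theorems

/-- **Valuation rings extend along a purely inseparable extension.** For fields `K ⊆ L` with
`L/K` purely inseparable and a valuation subring `O` of `K` there is a valuation subring `O'` of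
`L` whose restriction to `K` is `O`. (Existence holds for every field extension, by Chevalley's
extension theorem: the local ring `O → L` is dominated by a valuation ring `O'` of `L`, and `O` is
maximal for domination among local subrings of `K`, so `O' ∩ K = O`.) -/
theorem stub_ttlValuationUp (K L : Type) [Field K] [Field L] [Algebra K L] [IsPurelyInseparable K L]
    (O : ValuationSubring K) : ∃ O' : ValuationSubring L, O'.comap (algebraMap K L) = O :=
  Literature.AlgebraicGeometry.Resolution.exists_valuationSubring_comap_eq O

end Summit.ResolutionOfSingularities.ResolutionOfSingularities.Theorems

end
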